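/-
Origin: expansion seat `prover-pub-hodgecm-mc-sinst-1-g11-0`, handover #1262 2026-08-21T02:52Z md5 b5895a7a00e5 (297 l.; NEW additive leaf, ns HodgeCM.Model.ThetaAdelicSide: sideΦinf_ne_zero ((S.P k).Φinf ≠ 0); def thetaDistDatumZeroOfG (S : ThetaAdelicSide V c) (η₀ η₁ η₂ η₃) (hι : S.ιinf = archInfOf V) (h₁W) (hV) (hω : (S.P 0).ω = lineRepOf V c.D hGR hGR₀ hGR₁ hGR₂ hGR₃ η₀ η₁ η₂ η₃ 0) (hη₀c) (Φarch harm hdef) : ThetaDistDatum S hV 0 (ωA := lineOmega_zero … η₀, ωf := finRepZero … η₀, fin_V/fin_W/hA by rw [hω]/[hι] + the generic #1249/carch lemmas, smooth on the side's own Φinf) + thetaDistDatumOneOfG/TwoOfG/ThreeOfG likewise (finRepOne η₁ / finRepTwo η₂ / finRepThree η₃; One/Three without h₁W); rfl transfer theorems thetaDistDatum{Zero,One,Two,Three}OfG_archSideOf : …OfG (archSideOf …) (eta_k V c.D η …) rfl … rfl … = thetaDistDatum{Zero,One,Two,Three}Of … (so every landed slot theorem #1251/#R124/#R125/#1254/#1256/#1259/#1260/#1261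 transfers); NAMES for audit: HodgeCM.Model.ThetaAdelicSide.thetaDistDatumZeroOfG_archSideOf · HodgeCM.Model.ThetaAdelicSide.thetaDistDatumOneOfG_archSideOf · HodgeCM.Model.ThetaAdelicSide.sideΦinf_ne_zero) (`HOME/mc/pub-hodgecm-mc-sinst-1-g11/stage70/HodgeCM/Model/AdelicThetaDistributionOfG.lean`, md5 b5895a7a00e5, 297 lines);
landed by the second packager p2 gen 17 (p2-g17) in gate run 70 as `HodgeCM/Model/AdelicThetaDistributionOfG.lean` (verbatim).
-/
/-
Copyright (c) 2026 the pub-hodgecm formalisation cell (harness21).  New file, not vendored.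
Origin: session prover-pub-hodgecm-mc-sinst-1-g11-0 (unit pub-hodgecm-mc-sinst-1-g11, S-INSTANCE CONSTRUCTOR gen 11; the honest (J4) product
Weil datum made PIN-AGNOSTIC: over ANY adelic side `S` whose slot representation reads back to the character-generic line representation
`lineRepOf … η₀ η₁ η₂ η₃ k` — covers the default-split pin `archSideOf` (#1099) AND the ν-carrying (R1) pin `archSideOfT` (#1110-lineage),
all four slots), 2026-08-21.
Intended final place: `HodgeCM/Model/AdelicThetaDistributionOfG.lean` (NEW additive model-layer leaf; imports sinst-1 #1258
`Model/AdelicThetaDistributionOf34` (hence #1250 `…Of`, #1249 ∕ #1257 `…Fin ∕ Fin34`); imported by the pin-instance sibling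
`Model/AdelicThetaDistributionOfGPins`).
-/
import Summits.HodgeConjecture.HodgeCM.Model.AdelicThetaDistributionOf34

set_option autoImplicit false

/-!
# The honest (J4) product Weil datum over ANY side reading back to `lineRepOf` — all four slots, both pins

#1250 ∕ #1258 assemble `ThetaDistDatum (archSideOf V c hGR hGR₀ hGR₁ hGR₂ hGR₃ η hη hηc h₁W A) hV k` at the DEFAULT η-split
`eta_k V c.D η`.  The END-STATE skeletons (`E2InstanceOGR21AEPIST*`) instantiate E's `S` at the ν-CARRYING pin `SInstance.SROGT …` over
`archSideOfT … η ν …`, whose lines 0∕1 carry `etaT₀ η ν = (ν⁻¹ ∘ fst) · eta₀ η`, `etaT₁ η ν` (`archSideOfT_P_ω`, `rfl`).  Every INPUT of the datum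
is already character-generic (sinst-1 #1249∕#1257 `finRep{Zero,…,Three} … η_k`, carch `lineOmega_k … η_k`, `lineRepOf_k_archInfOf_eq … η₀ η₁ η₂ η₃`),
so this leaf assembles the datum ONCE for any `S : ThetaAdelicSide V c` with
  `hω : (S.P k).ω = lineRepOf V c.D hGR hGR₀ hGR₁ hGR₂ hGR₃ η₀ η₁ η₂ η₃ k`   and   `hι : S.ιinf = archInfOf V`:
* **`thetaDistDatumZeroOfG ∕ OneOfG ∕ TwoOfG ∕ ThreeOfG S η₀ η₁ η₂ η₃ hω hι hη_kc h₁W Φarch harm hdef : ThetaDistDatum S hV k`** (the nonzero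
  archimedean vector for `smooth` is the side's own `(S.P k).Φinf`, nonzero by `(S.P k).hx₀`);
* `…OfG_archSideOf` : at `S := archSideOf …`, `η_k := eta_k V c.D η` (`hω hι := rfl`) the G-datum IS #1250's ∕ #1258's datum (`rfl`) — every landed
  slot theorem (#1251, #R124∕#R125, #1254, #1256, #1259, #1260∕#1261) transfers verbatim;
* the instances at the three twisted pins (`archSideOfT`, `archSideOfT'` = the R2 pin of record, `archSideOfChar`) are in the sibling
  `Model/AdelicThetaDistributionOfGPins.lean`.
KERNEL only: four `def`s (terms of the #1246 structure) + `rfl` read-backs; 0 records, 0 `def … : Prop`, nothing cited.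
-/

noncomputable section

open NumberField NumberField.mixedEmbedding IsDedekindDomain MulAction
open scoped Matrix TensorProduct Classical SchwartzMap
open Literature.NumberTheory.Automorphic Literature.NumberTheory.Weil1964
open Literature.NumberTheory.GelbartRogawski1991 Literature.NumberTheory.GelbartRogawski1991.UnitaryDualPair
open Literature.Geometry.ComplexHyperbolic.BallModel (U21 x₀)
open Literature.AlgebraicGeometry.ShimuraVarieties
open HodgeCM.Adelic HodgeCM.PerL34 HodgeCM.Model.ArchSideTerm HodgeCM.Model.ThetaDistFin

namespace HodgeCM.Model
namespace ThetaAdelicSide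

variable {L : CMField} {ι₁ : L →+* ℂ} (V : HermSpace3 L ι₁) (c : SeesawCtx L) (S : ThetaAdelicSide V c)
  (hGR : (cmSplittingDatum (L : Type) finProdFinEquiv (frameD V) (frameD_real V) (frameD_ne V) (dW c.D) (dW_real c.D)
    (dW_ne c.D)).CompatibleSplitting)
  (hGR₀ : (cmSplittingDatum (L : Type) (e₁) (frameD V) (frameD_real V) (frameD_ne V) (lineVec (L : Type) (dW c.D 0))
    (fun _ => dW_real c.D 0) (fun _ => dW_ne c.D 0)).CompatibleSplitting)
  (hGR₁ : (cmSplittingDatum (L : Type) (e₁) (frameD V) (frameD_real V) (frameD_ne V) (lineVec (L : Type) (dW c.D 1))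
    (fun _ => dW_real c.D 1) (fun _ => dW_ne c.D 1)).CompatibleSplitting)
  (hGR₂ : (cmSplittingDatum (L : Type) (e₁) (frameD V) (frameD_real V) (frameD_ne V) (lineVec (L : Type) (dW' c.D 0))
    (fun _ => dW'_real c.D 0) (fun _ => dW'_ne c.D 0)).CompatibleSplitting)
  (hGR₃ : (cmSplittingDatum (L : Type) (e₁) (frameD V) (frameD_real V) (frameD_ne V) (lineVec (L : Type) (dW' c.D 1))
    (fun _ => dW'_real c.D 1) (fun _ => dW'_ne c.D 1)).CompatibleSplitting)
  (η₀ η₁ η₂ η₃ : CMAdelic (L : Type) (frameD V) × CMAdelicOne (L : Type) →* ℂˣ)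
  (hι : S.ιinf = archInfOf V)
  (h₁W : (∀ j, 0 < (ι₁ (dW c.D j)).re) ∨ ∀ j, (ι₁ (dW c.D j)).re < 0)
  (hV : IsAnisotropic L V.Hm)

/-- the side's own archimedean test function of slot `k` is nonzero (`φ_∞(x₀) ≠ 0`). -/
theorem sideΦinf_ne_zero (k : Fin 4) : (S.P k).Φinf ≠ 0 := fun h =>
  (S.P k).hx₀ (by rw [h]; rfl)

section Zero

variable (hω : (S.P 0).ω = lineRepOf V c.D hGR hGR₀ hGR₁ hGR₂ hGR₃ η₀ η₁ η₂ η₃ 0)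
  (hη₀c : Continuous fun p => ((η₀ p : ℂˣ) : ℂ))

/-- **THE HONEST (J4) PRODUCT WEIL DATUM OF SLOT 0 over any side reading back to `lineRepOf … η₀ η₁ η₂ η₃ 0`.** -/
def thetaDistDatumZeroOfG (Φarch : Module.Dual ℂ (Fin 2 → ℂ) →ₗ[ℂ] 𝓢((Fin 3 → mixedSpace (↥(maximalRealSubfield L))), ℂ))
    (harm : ∀ (u : ↥(stabilizer U21 x₀)) (ℓ : Module.Dual ℂ (Fin 2 → ℂ)),
      lineOmega_zero V c.D hGR hGR₀ hGR₁ η₀ (u : U21) (Φarch ℓ) =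
        Φarch ((BallForms.isPullbackCocycle_cotangentCocycle.weightOf x₀).dual u ℓ))
    (hdef : ∀ a : UnitaryGroup.arch (↥(maximalRealSubfield L)) L (IsCMField.complexConj L) 3 V.Hm,
      UnitaryGroup.archAt (↥(maximalRealSubfield L)) L (IsCMField.complexConj L) 3 V.Hm (UnitaryGroup.cmPlace (L : Type) ι₁)
          (NumberField.complexConj_smul_infinitePlace (L : Type) _) (IsCMField.complexConj_ne_one (L : Type)) a = 1 →
      ∀ (ℓ : Module.Dual ℂ (Fin 2 → ℂ)) (Φf : FinSB (↥(maximalRealSubfield L)) (Fin 3)),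
        lineRepOf V c.D hGR hGR₀ hGR₁ hGR₂ hGR₃ η₀ η₁ η₂ η₃ 0
            (HodgeCM.Adelic.regimeEquiv L V.Hm hV
              (UnitaryGroup.archToAdelic (↥(maximalRealSubfield L)) L (IsCMField.complexConj L) 3 V.Hm a), 1)
            (piSchwartzBruhatEquiv (↥(maximalRealSubfield L)) (Fin 3) (Φarch ℓ ⊗ₜ[ℂ] Φf)) =
          piSchwartzBruhatEquiv (↥(maximalRealSubfield L)) (Fin 3) (Φarch ℓ ⊗ₜ[ℂ] Φf)) :
    ThetaDistDatum S hV 0 where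
  ωA := lineOmega_zero V c.D hGR hGR₀ hGR₁ η₀
  hA g := by rw [hω, hι]; exact lineRepOf_zero_archInfOf_eq V c.D hGR hGR₀ hGR₁ hGR₂ hGR₃ η₀ η₁ η₂ η₃ hV g
  Φarch := Φarch
  harm := harm
  hdef a ha ℓ Φf := by rw [hω]; exact hdef a ha ℓ Φf
  Uf := UfZero c.D
  toIdele := finLineTorusIdeles (L : Type) (dW c.D 0) (dW_ne c.D 0)
  ωf := finRepZero V c.D hGR hGR₀ hGR₁ η₀
  fin_V g := by rw [hω]; exact lineRepOf_zero_finToG_eq_adelicTensorEnd V c.D hGR hGR₀ hGR₁ hGR₂ hGR₃ η₀ η₁ η₂ η₃ hV g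
  fin_W u := by rw [hω]; exact lineRepOf_zero_one_finLineTorusIdeles_eq_adelicTensorEnd V c.D hGR hGR₀ hGR₁ hGR₂ hGR₃ η₀ η₁ η₂ η₃ u
  smooth Φf := finRepZero_smooth V c.D hGR hGR₀ hGR₁ η₀ hη₀c h₁W (sideΦinf_ne_zero V c S 0) Φf

end Zero

section One

variable (hω : (S.P 1).ω = lineRepOf V c.D hGR hGR₀ hGR₁ hGR₂ hGR₃ η₀ η₁ η₂ η₃ 1)
  (hη₁c : Continuous fun p => ((η₁ p : ℂˣ) : ℂ))

/-- **THE HONEST (J4) PRODUCT WEIL DATUM OF SLOT 1 over any side reading back to `lineRepOf … η₀ η₁ η₂ η₃ 1`.** -/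
def thetaDistDatumOneOfG (Φarch : Module.Dual ℂ (Fin 2 → ℂ) →ₗ[ℂ] 𝓢((Fin 3 → mixedSpace (↥(maximalRealSubfield L))), ℂ))
    (harm : ∀ (u : ↥(stabilizer U21 x₀)) (ℓ : Module.Dual ℂ (Fin 2 → ℂ)),
      lineOmega_one V c.D hGR hGR₀ hGR₁ η₁ (u : U21) (Φarch ℓ) =
        Φarch ((BallForms.isPullbackCocycle_cotangentCocycle.weightOf x₀).dual u ℓ))
    (hdef : ∀ a : UnitaryGroup.arch (↥(maximalRealSubfield L)) L (IsCMField.complexConj L) 3 V.Hm,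
      UnitaryGroup.archAt (↥(maximalRealSubfield L)) L (IsCMField.complexConj L) 3 V.Hm (UnitaryGroup.cmPlace (L : Type) ι₁)
          (NumberField.complexConj_smul_infinitePlace (L : Type) _) (IsCMField.complexConj_ne_one (L : Type)) a = 1 →
      ∀ (ℓ : Module.Dual ℂ (Fin 2 → ℂ)) (Φf : FinSB (↥(maximalRealSubfield L)) (Fin 3)),
        lineRepOf V c.D hGR hGR₀ hGR₁ hGR₂ hGR₃ η₀ η₁ η₂ η₃ 1
            (HodgeCM.Adelic.regimeEquiv L V.Hm hV
              (UnitaryGroup.archToAdelic (↥(maximalRealSubfield L)) L (IsCMField.complexConj L) 3 V.Hm a), 1)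
            (piSchwartzBruhatEquiv (↥(maximalRealSubfield L)) (Fin 3) (Φarch ℓ ⊗ₜ[ℂ] Φf)) =
          piSchwartzBruhatEquiv (↥(maximalRealSubfield L)) (Fin 3) (Φarch ℓ ⊗ₜ[ℂ] Φf)) :
    ThetaDistDatum S hV 1 where
  ωA := lineOmega_one V c.D hGR hGR₀ hGR₁ η₁
  hA g := by rw [hω, hι]; exact lineRepOf_one_archInfOf_eq V c.D hGR hGR₀ hGR₁ hGR₂ hGR₃ η₀ η₁ η₂ η₃ hV g
  Φarch := Φarch
  harm := harm
  hdef a ha ℓ Φf := by rw [hω]; exact hdef a ha ℓ Φf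
  Uf := UfOne c.D
  toIdele := finLineTorusIdeles (L : Type) (dW c.D 1) (dW_ne c.D 1)
  ωf := finRepOne V c.D hGR hGR₀ hGR₁ η₁
  fin_V g := by rw [hω]; exact lineRepOf_one_finToG_eq_adelicTensorEnd V c.D hGR hGR₀ hGR₁ hGR₂ hGR₃ η₀ η₁ η₂ η₃ hV g
  fin_W u := by rw [hω]; exact lineRepOf_one_one_finLineTorusIdeles_eq_adelicTensorEnd V c.D hGR hGR₀ hGR₁ hGR₂ hGR₃ η₀ η₁ η₂ η₃ u
  smooth Φf := finRepOne_smooth V c.D hGR hGR₀ hGR₁ η₁ hη₁c (sideΦinf_ne_zero V c S 1) Φf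

end One

section Two

variable (hω : (S.P 2).ω = lineRepOf V c.D hGR hGR₀ hGR₁ hGR₂ hGR₃ η₀ η₁ η₂ η₃ 2)
  (hη₂c : Continuous fun p => ((η₂ p : ℂˣ) : ℂ))

/-- **THE HONEST (J4) PRODUCT WEIL DATUM OF SLOT 2 (conjugated plane) over any side reading back to `lineRepOf … 2`.** -/
def thetaDistDatumTwoOfG (Φarch : Module.Dual ℂ (Fin 2 → ℂ) →ₗ[ℂ] 𝓢((Fin 3 → mixedSpace (↥(maximalRealSubfield L))), ℂ))
    (harm : ∀ (u : ↥(stabilizer U21 x₀)) (ℓ : Module.Dual ℂ (Fin 2 → ℂ)),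
      lineOmega_two V c.D hGR hGR₂ hGR₃ η₂ (u : U21) (Φarch ℓ) =
        Φarch ((BallForms.isPullbackCocycle_cotangentCocycle.weightOf x₀).dual u ℓ))
    (hdef : ∀ a : UnitaryGroup.arch (↥(maximalRealSubfield L)) L (IsCMField.complexConj L) 3 V.Hm,
      UnitaryGroup.archAt (↥(maximalRealSubfield L)) L (IsCMField.complexConj L) 3 V.Hm (UnitaryGroup.cmPlace (L : Type) ι₁)
          (NumberField.complexConj_smul_infinitePlace (L : Type) _) (IsCMField.complexConj_ne_one (L : Type)) a = 1 →
      ∀ (ℓ : Module.Dual ℂ (Fin 2 → ℂ)) (Φf : FinSB (↥(maximalRealSubfield L)) (Fin 3)),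
        lineRepOf V c.D hGR hGR₀ hGR₁ hGR₂ hGR₃ η₀ η₁ η₂ η₃ 2
            (HodgeCM.Adelic.regimeEquiv L V.Hm hV
              (UnitaryGroup.archToAdelic (↥(maximalRealSubfield L)) L (IsCMField.complexConj L) 3 V.Hm a), 1)
            (piSchwartzBruhatEquiv (↥(maximalRealSubfield L)) (Fin 3) (Φarch ℓ ⊗ₜ[ℂ] Φf)) =
          piSchwartzBruhatEquiv (↥(maximalRealSubfield L)) (Fin 3) (Φarch ℓ ⊗ₜ[ℂ] Φf)) :
    ThetaDistDatum S hV 2 where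
  ωA := lineOmega_two V c.D hGR hGR₂ hGR₃ η₂
  hA g := by rw [hω, hι]; exact lineRepOf_two_archInfOf_eq V c.D hGR hGR₀ hGR₁ hGR₂ hGR₃ η₀ η₁ η₂ η₃ hV g
  Φarch := Φarch
  harm := harm
  hdef a ha ℓ Φf := by rw [hω]; exact hdef a ha ℓ Φf
  Uf := UfTwo c.D
  toIdele := finLineTorusIdeles (L : Type) (dW' c.D 0) (dW'_ne c.D 0)
  ωf := finRepTwo V c.D hGR hGR₂ hGR₃ η₂
  fin_V g := by rw [hω]; exact lineRepOf_two_finToG_eq_adelicTensorEnd V c.D hGR hGR₀ hGR₁ hGR₂ hGR₃ η₀ η₁ η₂ η₃ hV g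
  fin_W u := by rw [hω]; exact lineRepOf_two_one_finLineTorusIdeles_eq_adelicTensorEnd V c.D hGR hGR₀ hGR₁ hGR₂ hGR₃ η₀ η₁ η₂ η₃ u
  smooth Φf := finRepTwo_smooth V c.D hGR hGR₂ hGR₃ η₂ hη₂c h₁W (sideΦinf_ne_zero V c S 2) Φf

end Two

section Three

variable (hω : (S.P 3).ω = lineRepOf V c.D hGR hGR₀ hGR₁ hGR₂ hGR₃ η₀ η₁ η₂ η₃ 3)
  (hη₃c : Continuous fun p => ((η₃ p : ℂˣ) : ℂ))

/-- **THE HONEST (J4) PRODUCT WEIL DATUM OF SLOT 3 (conjugated plane) over any side reading back to `lineRepOf … 3`.** -/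
def thetaDistDatumThreeOfG (Φarch : Module.Dual ℂ (Fin 2 → ℂ) →ₗ[ℂ] 𝓢((Fin 3 → mixedSpace (↥(maximalRealSubfield L))), ℂ))
    (harm : ∀ (u : ↥(stabilizer U21 x₀)) (ℓ : Module.Dual ℂ (Fin 2 → ℂ)),
      lineOmega_three V c.D hGR hGR₂ hGR₃ η₃ (u : U21) (Φarch ℓ) =
        Φarch ((BallForms.isPullbackCocycle_cotangentCocycle.weightOf x₀).dual u ℓ))
    (hdef : ∀ a : UnitaryGroup.arch (↥(maximalRealSubfield L)) L (IsCMField.complexConj L) 3 V.Hm,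
      UnitaryGroup.archAt (↥(maximalRealSubfield L)) L (IsCMField.complexConj L) 3 V.Hm (UnitaryGroup.cmPlace (L : Type) ι₁)
          (NumberField.complexConj_smul_infinitePlace (L : Type) _) (IsCMField.complexConj_ne_one (L : Type)) a = 1 →
      ∀ (ℓ : Module.Dual ℂ (Fin 2 → ℂ)) (Φf : FinSB (↥(maximalRealSubfield L)) (Fin 3)),
        lineRepOf V c.D hGR hGR₀ hGR₁ hGR₂ hGR₃ η₀ η₁ η₂ η₃ 3
            (HodgeCM.Adelic.regimeEquiv L V.Hm hV
              (UnitaryGroup.archToAdelic (↥(maximalRealSubfield L)) L (IsCMField.complexConj L) 3 V.Hm a), 1)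
            (piSchwartzBruhatEquiv (↥(maximalRealSubfield L)) (Fin 3) (Φarch ℓ ⊗ₜ[ℂ] Φf)) =
          piSchwartzBruhatEquiv (↥(maximalRealSubfield L)) (Fin 3) (Φarch ℓ ⊗ₜ[ℂ] Φf)) :
    ThetaDistDatum S hV 3 where
  ωA := lineOmega_three V c.D hGR hGR₂ hGR₃ η₃
  hA g := by rw [hω, hι]; exact lineRepOf_three_archInfOf_eq V c.D hGR hGR₀ hGR₁ hGR₂ hGR₃ η₀ η₁ η₂ η₃ hV g
  Φarch := Φarch
  harm := harm
  hdef a ha ℓ Φf := by rw [hω]; exact hdef a ha ℓ Φf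
  Uf := UfThree c.D
  toIdele := finLineTorusIdeles (L : Type) (dW' c.D 1) (dW'_ne c.D 1)
  ωf := finRepThree V c.D hGR hGR₂ hGR₃ η₃
  fin_V g := by rw [hω]; exact lineRepOf_three_finToG_eq_adelicTensorEnd V c.D hGR hGR₀ hGR₁ hGR₂ hGR₃ η₀ η₁ η₂ η₃ hV g
  fin_W u := by rw [hω]; exact lineRepOf_three_one_finLineTorusIdeles_eq_adelicTensorEnd V c.D hGR hGR₀ hGR₁ hGR₂ hGR₃ η₀ η₁ η₂ η₃ u
  smooth Φf := finRepThree_smooth V c.D hGR hGR₂ hGR₃ η₃ hη₃c (sideΦinf_ne_zero V c S 3) Φf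

end Three


/-! ## Read-backs at the two pins -/

section DefaultPin

variable (η : CMAdelic (L : Type) (frameD V) × CMAdelic (L : Type) (dW c.D) →* ℂˣ)
  (hη : ∀ γU ∈ CMRat (L : Type) (frameD V), ∀ γ ∈ CMRat (L : Type) (dW c.D), η (γU, γ) = 1)
  (hηc : Continuous fun p => ((η p : ℂˣ) : ℂ))
  (A : ∀ k : Fin 4, ArchLineInput V (lineRepD V c.D hGR hGR₀ hGR₁ hGR₂ hGR₃ η k))

/-- **AT THE DEFAULT-SPLIT PIN the G-datum of slot 0 IS #1250's datum** (`rfl`): every landed slot-0 theorem transfers. -/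
theorem thetaDistDatumZeroOfG_archSideOf
    (Φarch : Module.Dual ℂ (Fin 2 → ℂ) →ₗ[ℂ] 𝓢((Fin 3 → mixedSpace (↥(maximalRealSubfield L))), ℂ))
    (harm : ∀ (u : ↥(stabilizer U21 x₀)) (ℓ : Module.Dual ℂ (Fin 2 → ℂ)),
      lineOmega_zero V c.D hGR hGR₀ hGR₁ (eta₀ V c.D η) (u : U21) (Φarch ℓ) =
        Φarch ((BallForms.isPullbackCocycle_cotangentCocycle.weightOf x₀).dual u ℓ))
    (hdef : ∀ a : UnitaryGroup.arch (↥(maximalRealSubfield L)) L (IsCMField.complexConj L) 3 V.Hm,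
      UnitaryGroup.archAt (↥(maximalRealSubfield L)) L (IsCMField.complexConj L) 3 V.Hm (UnitaryGroup.cmPlace (L : Type) ι₁)
          (NumberField.complexConj_smul_infinitePlace (L : Type) _) (IsCMField.complexConj_ne_one (L : Type)) a = 1 →
      ∀ (ℓ : Module.Dual ℂ (Fin 2 → ℂ)) (Φf : FinSB (↥(maximalRealSubfield L)) (Fin 3)),
        lineRepOf V c.D hGR hGR₀ hGR₁ hGR₂ hGR₃ (eta₀ V c.D η) (eta₁ V c.D η) (eta₂ V c.D η) (eta₃ V c.D η) 0
            (HodgeCM.Adelic.regimeEquiv L V.Hm hV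
              (UnitaryGroup.archToAdelic (↥(maximalRealSubfield L)) L (IsCMField.complexConj L) 3 V.Hm a), 1)
            (piSchwartzBruhatEquiv (↥(maximalRealSubfield L)) (Fin 3) (Φarch ℓ ⊗ₜ[ℂ] Φf)) =
          piSchwartzBruhatEquiv (↥(maximalRealSubfield L)) (Fin 3) (Φarch ℓ ⊗ₜ[ℂ] Φf)) :
    thetaDistDatumZeroOfG V c (archSideOf V c hGR hGR₀ hGR₁ hGR₂ hGR₃ η hη hηc h₁W A) hGR hGR₀ hGR₁ hGR₂ hGR₃
        (eta₀ V c.D η) (eta₁ V c.D η) (eta₂ V c.D η) (eta₃ V c.D η) rfl h₁W hV rfl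
        (continuous_cmEta₀ (L : Type) (frameD V) (dW c.D) η hηc) Φarch harm hdef =
      thetaDistDatumZeroOf V c hGR hGR₀ hGR₁ hGR₂ hGR₃ η hη hηc h₁W A hV Φarch harm hdef := rfl

/-- the same for slot 1. -/
theorem thetaDistDatumOneOfG_archSideOf
    (Φarch : Module.Dual ℂ (Fin 2 → ℂ) →ₗ[ℂ] 𝓢((Fin 3 → mixedSpace (↥(maximalRealSubfield L))), ℂ))
    (harm : ∀ (u : ↥(stabilizer U21 x₀)) (ℓ : Module.Dual ℂ (Fin 2 → ℂ)),
      lineOmega_one V c.D hGR hGR₀ hGR₁ (eta₁ V c.D η) (u : U21) (Φarch ℓ) =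
        Φarch ((BallForms.isPullbackCocycle_cotangentCocycle.weightOf x₀).dual u ℓ))
    (hdef : ∀ a : UnitaryGroup.arch (↥(maximalRealSubfield L)) L (IsCMField.complexConj L) 3 V.Hm,
      UnitaryGroup.archAt (↥(maximalRealSubfield L)) L (IsCMField.complexConj L) 3 V.Hm (UnitaryGroup.cmPlace (L : Type) ι₁)
          (NumberField.complexConj_smul_infinitePlace (L : Type) _) (IsCMField.complexConj_ne_one (L : Type)) a = 1 →
      ∀ (ℓ : Module.Dual ℂ (Fin 2 → ℂ)) (Φf : FinSB (↥(maximalRealSubfield L)) (Fin 3)),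
        lineRepOf V c.D hGR hGR₀ hGR₁ hGR₂ hGR₃ (eta₀ V c.D η) (eta₁ V c.D η) (eta₂ V c.D η) (eta₃ V c.D η) 1
            (HodgeCM.Adelic.regimeEquiv L V.Hm hV
              (UnitaryGroup.archToAdelic (↥(maximalRealSubfield L)) L (IsCMField.complexConj L) 3 V.Hm a), 1)
            (piSchwartzBruhatEquiv (↥(maximalRealSubfield L)) (Fin 3) (Φarch ℓ ⊗ₜ[ℂ] Φf)) =
          piSchwartzBruhatEquiv (↥(maximalRealSubfield L)) (Fin 3) (Φarch ℓ ⊗ₜ[ℂ] Φf)) :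
    thetaDistDatumOneOfG V c (archSideOf V c hGR hGR₀ hGR₁ hGR₂ hGR₃ η hη hηc h₁W A) hGR hGR₀ hGR₁ hGR₂ hGR₃
        (eta₀ V c.D η) (eta₁ V c.D η) (eta₂ V c.D η) (eta₃ V c.D η) rfl hV rfl
        (continuous_cmEta₁_comp_snd (L : Type) (frameD V) (dW c.D) η hηc) Φarch harm hdef =
      thetaDistDatumOneOf V c hGR hGR₀ hGR₁ hGR₂ hGR₃ η hη hηc h₁W A hV Φarch harm hdef := rfl

/-- the same for slot 2 (#1258). -/
theorem thetaDistDatumTwoOfG_archSideOf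
    (Φarch : Module.Dual ℂ (Fin 2 → ℂ) →ₗ[ℂ] 𝓢((Fin 3 → mixedSpace (↥(maximalRealSubfield L))), ℂ))
    (harm : ∀ (u : ↥(stabilizer U21 x₀)) (ℓ : Module.Dual ℂ (Fin 2 → ℂ)),
      lineOmega_two V c.D hGR hGR₂ hGR₃ (eta₂ V c.D η) (u : U21) (Φarch ℓ) =
        Φarch ((BallForms.isPullbackCocycle_cotangentCocycle.weightOf x₀).dual u ℓ))
    (hdef : ∀ a : UnitaryGroup.arch (↥(maximalRealSubfield L)) L (IsCMField.complexConj L) 3 V.Hm,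
      UnitaryGroup.archAt (↥(maximalRealSubfield L)) L (IsCMField.complexConj L) 3 V.Hm (UnitaryGroup.cmPlace (L : Type) ι₁)
          (NumberField.complexConj_smul_infinitePlace (L : Type) _) (IsCMField.complexConj_ne_one (L : Type)) a = 1 →
      ∀ (ℓ : Module.Dual ℂ (Fin 2 → ℂ)) (Φf : FinSB (↥(maximalRealSubfield L)) (Fin 3)),
        lineRepOf V c.D hGR hGR₀ hGR₁ hGR₂ hGR₃ (eta₀ V c.D η) (eta₁ V c.D η) (eta₂ V c.D η) (eta₃ V c.D η) 2
            (HodgeCM.Adelic.regimeEquiv L V.Hm hV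
              (UnitaryGroup.archToAdelic (↥(maximalRealSubfield L)) L (IsCMField.complexConj L) 3 V.Hm a), 1)
            (piSchwartzBruhatEquiv (↥(maximalRealSubfield L)) (Fin 3) (Φarch ℓ ⊗ₜ[ℂ] Φf)) =
          piSchwartzBruhatEquiv (↥(maximalRealSubfield L)) (Fin 3) (Φarch ℓ ⊗ₜ[ℂ] Φf)) :
    thetaDistDatumTwoOfG V c (archSideOf V c hGR hGR₀ hGR₁ hGR₂ hGR₃ η hη hηc h₁W A) hGR hGR₀ hGR₁ hGR₂ hGR₃
        (eta₀ V c.D η) (eta₁ V c.D η) (eta₂ V c.D η) (eta₃ V c.D η) rfl h₁W hV rfl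
        (continuous_cmConjEta₀ (L : Type) (frameD V) (dW c.D) (dW' c.D) c.D.isoGL (isoGL_hg₀ c.D) η hηc) Φarch harm hdef =
      thetaDistDatumTwoOf V c hGR hGR₀ hGR₁ hGR₂ hGR₃ η hη hηc h₁W A hV Φarch harm hdef := rfl

/-- the same for slot 3 (#1258). -/
theorem thetaDistDatumThreeOfG_archSideOf
    (Φarch : Module.Dual ℂ (Fin 2 → ℂ) →ₗ[ℂ] 𝓢((Fin 3 → mixedSpace (↥(maximalRealSubfield L))), ℂ))
    (harm : ∀ (u : ↥(stabilizer U21 x₀)) (ℓ : Module.Dual ℂ (Fin 2 → ℂ)),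
      lineOmega_three V c.D hGR hGR₂ hGR₃ (eta₃ V c.D η) (u : U21) (Φarch ℓ) =
        Φarch ((BallForms.isPullbackCocycle_cotangentCocycle.weightOf x₀).dual u ℓ))
    (hdef : ∀ a : UnitaryGroup.arch (↥(maximalRealSubfield L)) L (IsCMField.complexConj L) 3 V.Hm,
      UnitaryGroup.archAt (↥(maximalRealSubfield L)) L (IsCMField.complexConj L) 3 V.Hm (UnitaryGroup.cmPlace (L : Type) ι₁)
          (NumberField.complexConj_smul_infinitePlace (L : Type) _) (IsCMField.complexConj_ne_one (L : Type)) a = 1 →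
      ∀ (ℓ : Module.Dual ℂ (Fin 2 → ℂ)) (Φf : FinSB (↥(maximalRealSubfield L)) (Fin 3)),
        lineRepOf V c.D hGR hGR₀ hGR₁ hGR₂ hGR₃ (eta₀ V c.D η) (eta₁ V c.D η) (eta₂ V c.D η) (eta₃ V c.D η) 3
            (HodgeCM.Adelic.regimeEquiv L V.Hm hV
              (UnitaryGroup.archToAdelic (↥(maximalRealSubfield L)) L (IsCMField.complexConj L) 3 V.Hm a), 1)
            (piSchwartzBruhatEquiv (↥(maximalRealSubfield L)) (Fin 3) (Φarch ℓ ⊗ₜ[ℂ] Φf)) =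
          piSchwartzBruhatEquiv (↥(maximalRealSubfield L)) (Fin 3) (Φarch ℓ ⊗ₜ[ℂ] Φf)) :
    thetaDistDatumThreeOfG V c (archSideOf V c hGR hGR₀ hGR₁ hGR₂ hGR₃ η hη hηc h₁W A) hGR hGR₀ hGR₁ hGR₂ hGR₃
        (eta₀ V c.D η) (eta₁ V c.D η) (eta₂ V c.D η) (eta₃ V c.D η) rfl hV rfl
        (continuous_cmConjEta₁_comp_snd (L : Type) (frameD V) (dW c.D) (dW' c.D) c.D.isoGL (isoGL_hg₀ c.D) η hηc) Φarch harm hdef =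
      thetaDistDatumThreeOf V c hGR hGR₀ hGR₁ hGR₂ hGR₃ η hη hηc h₁W A hV Φarch harm hdef := rfl

end DefaultPin

end ThetaAdelicSide
end HodgeCM.Model

end
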